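import Literature.MathematicalPhysics.QuantumFieldTheory.Balaban1983to89.B9Letters313AtOneL2

/-!
# `Balaban1983to89.B9Letters313AtOneL2Dv` — [B9] Thm 3.13's BLOCK-L² reduction letters AT THE TRIVIAL BACKGROUND, second batch: the `G₀∘D_v` letters
# `Letters313L2PZ.gDv ∕ dGDv` (`‖1_{Δ(y)}G₀(1)D_v(1)λ‖ ≤ B₄·Lʲη·e^{−δd}‖λ‖`, `‖1_{Δ(y)}∇G₀(1)D_v(1)λ‖ ≤ B₄·e^{−δd}‖λ‖`) HOLD AT `U = 1`, and
# `gQs ∕ gDv ∕ dGQs ∕ dGDv` UNIFORMLY on the k-level census — [4] (2.140)₃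
# (`G∇*_μ`) read onto `G₀∂` through `∂λ = −Σ_μ∇*_μJ_μ(λ)` in `L²`

T. Bałaban, *Propagators for lattice gauge theories in a background field*, Commun. Math. Phys. **99** (1985) 389–434
[`Balaban1985BackgroundPropagators`, "B9"]; [4] = T. Bałaban, *Propagators and renormalization transformations for lattice gauge
theories. II*, Commun. Math. Phys. **96** (1984) 223–250 [`Balaban1984PropagatorsII`].

statement-level skeleton of published theorems with citation tags; proofs where landed; nothing here is a claim about the Yang–Mills mass gap

THE PRINTED LOCI (verbatim).  [B9] p. 426 (Thm 3.13), (3.153) (`G₁DRD*G₁`, `D` the gauge-sector gradient (3.3) p. 390); (3.46) p. 398; Cor. 3.5 p. 407;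
[4] Prop. 2.6 (2.140) p. 247 (third member `‖ζG∇*J‖ ≤ O(1)L^jη|ζ|e^{−δ₃d}‖J‖`), (2.54) p. 233, Lemma 2.1 (2.60)–(2.61) p. 234; [5] (1.4) p. 18.

THE POINT.  Sequel of `B9Letters313AtOneL2` (the `Q*` side).  §1 the direction slices `J_μ(λ)(b) := [b.dir = μ]·λ(b₊)` of `B9Letters313AtOneDv` in `L²`:
`slice_supp` (spread `2`: `hβ1` + `distB_blkV1_shift_le_one`), `l2_slice_le` (`‖J_μ(λ)‖ = ‖λ‖`: the bonds of direction `μ` are the shifted sites),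
`toLin_gradK_eq_neg_sum` (`∂♭ = −Σ_μ ∇*_μ ∘ J_μ` as linear maps, from `onFun_dE_eq_neg_sum_DVa`), ★★ `blockBd_comp_gradK_sIK_bI` (the `d+1` sources fed to
`B9BlockL2ReblockEngine.blockBd_comp_reblock`, summed by `blockBd_sum ∕ blockBd_neg`), ★★★ `blockBd_G0_Dv_one` — the `gDv` shape
`BlockBd 𝔬.blkW 𝔬.blk (𝔬.G0 U₁ ∘ₗ 𝔬.Dv U₁) (cR39 b·(d+1)·C·c·e^{9δ∕4}·√(e^{δ∕4}c)·len y·e^{−¾δd})` at ANY letter record pinned to `GcoK … O ∕ DvcoKH`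
(`hG0co12 ∕ hDvco12`), `blk = blkBK bI` (`hblk12`), `blkW = blkSK (sIK bI)` (the site pin, edition 23's `hblkW12`); `DcoK_GcoK_comp_DvcoKH_one`,
`cdB_O_gradY_one_liftY`, ★★★ `blockBd_D_G0_Dv_one` — the `dGDv` shape ((2.140)₄ `∇G∇*`, order zero, target `blkY`, pin `hDco12`); §2 ★★★
`letters313_L2_one_kIdx` — `gQs ∕ gDv ∕ dGQs ∕ dGDv` uniformly on the census (one threshold `M₁`, one constant `B₄`, rate `δ₃∕2`; `B9Prop26L2AtPinsOne.blockBd_Gop_kIdx` + `consts_260_261` +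
`transfer_threshold`).

HONEST SCOPE.  A READING file, inputs cited by name; nothing of [B9] at curved `U` asserted; `hLL2` NOT witnessed (A6 partial witnesses at `U = 1`: four
of its fifteen fields); COUNT-NEUTRAL; N06 NOT discharged; one finite lattice at a time; nothing continuum, nothing about the mass gap.  Cell `pub-ymgap`
(HUMAN RULING D-0062 ∕ D-0149), node N06 [B9], rows 20–21 JSAT lane, width seat `pub-ymgap-dag-n06-w3` (g2), 2026-08-28.
-/

noncomputable section

namespace Literature.MathematicalPhysics.QuantumFieldTheory.Balaban1983to89.B9Letters313AtOneL2Dv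

open B6MultiLevelTorusOperator (TDomains) open B6Geom246MultiLevelTorus (geomT) open B6GlobalChartV1 (PV blkV1 boxEquiv toBox)
open B6KLevelCensusIndexV1 (KIdx kGeo kGeoG) open B6Prop26Census2136KLevelV1 (Gop) open B6RandomWalk (HasMajorant BlockSupp blockPiece sum_blockPiece)
open B6RandomWalkHom (HasMajorantHom) open B6GradLegKLevelV1 (DV) open B6LapLegKLevelV1 (DVa DVa_apply) open B6Ineq2133TwoScaleV1 (onFun onFun_apply)
open B6SectAOperatorsV1 (dE) open B10StarCount (shift_unshift unshift_shift shiftEquiv sum_pbond)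
open B6Ineq2142KLevelV1 (lvl β qwt qwt_le qwt_nonneg) open B6Ineq288MultiLevelTorus (dist_symm_geoBT) open B9Thm314GpFlatMultiLevelTorus (consts_260_261)
open B6Lemma21Repaired (Ineq261With) open B9GeoNormsKLevelV1 (geo9K) open B9GeoLemma21KLevelV1 (one_le_Mh geo9K_len_pos geo9K_dist_comm geo9K_M_nonneg)
open B9Ineq349SiteComposite (distB distB_nonneg) open B9Ineq349SiteFromBlocks (distB_triangle) open B9Thm39ReadingCoords (cR39 cR39_nonneg)
open B9CoReadingCoords B9CoReadingCoordsH open B9CoReadingCoordsS (XSK blkSK sIK blkV1_site) open B9Thm34Ext (toB6) open B9SectDL2Decay (bsq bl2 BlockBd)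
open B9Eq3132Ineq2142Covariant (qK_apply sum_qwt_eq_one) open B9Prop26AtPinsOne (coordOpKH_apply_of_liftY)
open B9LettersHAtOneG0 (qsK_mulVec_apply qwt_le_one dist_blkV1_le_of_qwt_ne_zero GcoK_comp_QscoKH_one O_QsY_one_liftY DcoK_GcoK_comp_QscoKH_one cdB_O_QsY_one_liftY)
open B9Letters313AtOneQ (len_pow_le_of_transfer transfer_threshold) open B9LettersHZAtOne (plateau_pos) open B9Cor35ComparisonsGAAtLetters (cdB_one_liftY)
open B9Letters313AtOneDv (onFun_dE_eq_neg_sum_DVa distB_blkV1_shift_le_one GcoK_comp_DvcoKH_one O_gradY_one_liftY)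
open B9Prop26L2AtPinsOne (blockBd_Gop_kIdx) open B9BlockL2ReblockEngine (blockBd_comp_reblock)
open B9Letters313AtOneL2 (blockBd_coordOpKH_of_liftY blockBd_smul_of_nonneg blockBd_sum blockBd_neg sliceMap_apply blockBd_G0_Qstar_one blockBd_D_G0_Qstar_one) open Node00 Node00.OpsYSectDCoords
open B9Thm312Whole B9Thm312WholeLeaf B9SectDSup B11SectG
open scoped Matrix

variable {d ℓ : ℕ} {hd : 1 ≤ d + 1} {hL : Odd (ℓ + 1) ∧ 1 < ℓ + 1} {b₀ b₁ : ℝ}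

/-! ## §1 AT THE PINS: the `G₀∘D_v` block-L² letters of `Letters313L2PZ` at a configuration reading `1` (the direction slices of §2 of
`B9Letters313AtOneDv`, in `L²`) -/

section DvLetters

variable (i : KIdx d ℓ hd hL b₀ b₁)

/-- **THE SLICE `J_μ` VANISHES OFF THE BONDS ONE SITE OFF THE SUPPORT**: for `ω` supported on the site fibre of `a′` (block map `sIK bI`, `bI` 1-faithful),
`J_μ(ω)` is supported within torus distance `2` of the carrier block of `a′`. [cite: Balaban1984PropagatorsII, (2.45)–(2.46) p.231, bookkeeping] -/
theorem slice_supp {bI : FBondY i → IBondY i} (hβ1 : ∀ f : FBondY i, (geomT i.D).dist (β i.hN i.D i.hk (bI f)) (blkV1 i.hN i.D f) ≤ 1)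
    (μ : Fin (d + 1)) {a' : IBondY i} {ω : SiteY i → ℝ} (hω : ∀ z, sIK i bI z ≠ a' → ω z = 0) (b' : FBondY i)
    (hb : (LinearMap.pi fun b' : FBondY i =>
      (if b'.dir = μ then LinearMap.proj (R := ℝ) (φ := fun _ : SiteY i => ℝ) (boxEquiv i.hN (b'.src.shift μ)) else 0)) ω b' ≠ 0) :
    distB i (β i.hN i.D i.hk a') (blkV1 i.hN i.D b') ≤ 2 := by
  rw [sliceMap_apply] at hb
  have hdir : b'.dir = μ := by by_contra h; rw [if_neg h] at hb; exact hb rfl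
  rw [if_pos hdir] at hb
  have ha : bI ⟨b'.src.shift μ, 0⟩ = a' := by
    by_contra hne; exact hb (hω _ (by rwa [sIK, Equiv.symm_apply_apply]))
  have h1 : distB i (β i.hN i.D i.hk a') (blkV1 i.hN i.D (⟨b'.src.shift μ, 0⟩ : FBondY i)) ≤ 1 := by rw [← ha]; exact hβ1 _
  have h2 : distB i (blkV1 i.hN i.D (⟨b'.src.shift μ, 0⟩ : FBondY i)) (blkV1 i.hN i.D b') ≤ 1 := by
    obtain ⟨x, ν⟩ := b'; exact distB_blkV1_shift_le_one i x μ 0 ν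
  linarith [distB_triangle i (β i.hN i.D i.hk a') (blkV1 i.hN i.D (⟨b'.src.shift μ, 0⟩ : FBondY i)) (blkV1 i.hN i.D b')]

/-- **THE FLAT `L²` NORM OF THE SLICE IS THAT OF THE SCALAR**: `Σ_b J_μ(ω)(b)² = Σ_z ω(z)²` (the bonds of direction `μ`, shifted, are in bijection with the
sites); for `ω` supported on the site fibre of `a′` this is the fibre size. [cite: Balaban1984PropagatorsII, (2.54) p.233, bookkeeping] -/
theorem l2_slice_le {bI : FBondY i → IBondY i} (μ : Fin (d + 1)) {a' : IBondY i} {ω : SiteY i → ℝ} (hω : ∀ z, sIK i bI z ≠ a' → ω z = 0)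
    (R₀ : ℝ) (H₀ : Prop) [Fintype (geo9K i).Site] :
    Real.sqrt (∑ b', (LinearMap.pi fun b' : FBondY i =>
      (if b'.dir = μ then LinearMap.proj (R := ℝ) (φ := fun _ : SiteY i => ℝ) (boxEquiv i.hN (b'.src.shift μ)) else 0)) ω b' ^ 2) ≤
      1 * bl2 (g := toB6 (geo9K i) R₀ H₀) (sIK i bI) a' ω := by
  classical
  rw [one_mul]
  unfold bl2 bsq
  apply Real.sqrt_le_sqrt
  have hlhs : ∑ b', (LinearMap.pi fun b' : FBondY i =>
      (if b'.dir = μ then LinearMap.proj (R := ℝ) (φ := fun _ : SiteY i => ℝ) (boxEquiv i.hN (b'.src.shift μ)) else 0)) ω b' ^ 2 =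
      ∑ z : SiteY i, ω z ^ 2 := by
    simp only [sliceMap_apply]
    rw [sum_pbond]
    simp only [ite_pow, ne_eq, OfNat.ofNat_ne_zero, not_false_eq_true, zero_pow, Finset.sum_ite_eq', Finset.mem_univ, if_true]
    -- `Σ_x ω(chart(x + e_μ))² = Σ_x ω(chart x)² = Σ_z ω(z)²`
    calc ∑ x, ω (boxEquiv i.hN (x.shift μ)) ^ 2 = ∑ x, ω (boxEquiv i.hN x) ^ 2 :=
          Fintype.sum_equiv (shiftEquiv (P := PV d ℓ i.m i.K hd hL) μ) _ _ (fun x => rfl)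
      _ = ∑ z : SiteY i, ω z ^ 2 := Fintype.sum_equiv (boxEquiv i.hN) _ _ (fun x => rfl)
  rw [hlhs]
  refine Finset.sum_le_sum fun z _ => ?_
  split_ifs with h
  · exact le_rfl
  · rw [hω z h]; simp

/-- **`∂♯ = −Σ_μ ∇*_μ ∘ J_μ` AS LINEAR MAPS** (the torus-chart identity `B9Letters313AtOneDv.onFun_dE_eq_neg_sum_DVa`, with the box chart).
[cite: Balaban1984PropagatorsI, (1.4) p.18, (1.89) p.33, bookkeeping] -/
theorem toLin_gradK_eq_neg_sum :
    Matrix.toLin' (gradK i) = -∑ μ : Fin (d + 1), DVa (P := PV d ℓ i.m i.K hd hL) μ i.cf ∘ₗ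
      (LinearMap.pi fun b' : FBondY i =>
        (if b'.dir = μ then LinearMap.proj (R := ℝ) (φ := fun _ : SiteY i => ℝ) (boxEquiv i.hN (b'.src.shift μ)) else 0)) := by
  apply LinearMap.ext; intro ω
  rw [Matrix.toLin'_apply, gradK_mulVec, onFun_dE_eq_neg_sum_DVa, LinearMap.neg_apply, LinearMap.sum_apply]
  congr 1
  refine Finset.sum_congr rfl fun μ _ => ?_
  rw [LinearMap.comp_apply]
  congr 1
  funext b'
  rw [sliceMap_apply]

/-- ★★ **THE REAL `T∘∂♯` IN BLOCK-L²** for an operator family: if every `T ∘ ∇*_μ` has the torus block-L² bound `C·ηᵐL^{mj}·e^{−δd}`, then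
`T ∘ gradK♭ : (sites, sIK bI) → (bonds, bI)` has the bound `(d+1)·C·c·e^{¾δ·3}·√(e^{δ∕4}c)·(Lʲη)(a)ᵐ·e^{−¾δd}`.
[cite: Balaban1984PropagatorsII, Prop. 2.6 (2.140) p.247, (2.54) p.233, Lemma 2.1 (2.61) p.234; Balaban1985BackgroundPropagators, (3.3) p.390, (3.46) p.398] -/
theorem blockBd_comp_gradK_sIK_bI {bI : FBondY i → IBondY i}
    (hlev : ∀ f : FBondY i, lvl i.hN i.D i.hk (bI f) = (blkV1 i.hN i.D f).1.1)
    (hβ1 : ∀ f : FBondY i, (geomT i.D).dist (β i.hN i.D i.hk (bI f)) (blkV1 i.hN i.D f) ≤ 1)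
    {T : Module.End ℝ (FBondY i → ℝ)} {C δ : ℝ} (hC : 0 ≤ C) (hδ : 0 ≤ δ) (m : ℕ)
    (hT : ∀ μ : Fin (d + 1), BlockBd (g := geomT i.D) (blkV1 i.hN i.D) (blkV1 i.hN i.D) (T ∘ₗ DVa (P := PV d ℓ i.m i.K hd hL) μ i.cf)
      (fun y y' => C * |i.cf|⁻¹ ^ m * ((ℓ : ℝ) + 1) ^ (m * y.1.1) * Real.exp (-(δ * (geomT i.D).dist y y'))))
    {c : ℝ} (h261 : Ineq261With c (geomT i.D) δ (1 / 4)) (R₀ : ℝ) (H₀ : Prop) [Fintype (geo9K i).Site] :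
    BlockBd (g := toB6 (geo9K i) R₀ H₀) (sIK i bI) bI (T ∘ₗ Matrix.toLin' (gradK i))
      (fun a a' => (((Finset.univ : Finset (Fin (d + 1))).card : ℝ)) *
        (C * c * Real.exp (3 / 4 * δ * (2 + 1)) * Real.sqrt (Real.exp (1 / 4 * δ) * c) * (geo9K i).len a ^ m *
          Real.exp (-(3 / 4 * δ * (geo9K i).dist a a')) * 1)) := by
  have hdec : T ∘ₗ Matrix.toLin' (gradK i) = -∑ μ : Fin (d + 1), (T ∘ₗ DVa (P := PV d ℓ i.m i.K hd hL) μ i.cf) ∘ₗ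
      (LinearMap.pi fun b' : FBondY i =>
        (if b'.dir = μ then LinearMap.proj (R := ℝ) (φ := fun _ : SiteY i => ℝ) (boxEquiv i.hN (b'.src.shift μ)) else 0)) := by
    rw [toLin_gradK_eq_neg_sum]
    apply LinearMap.ext; intro ω
    simp only [LinearMap.comp_apply, LinearMap.neg_apply, LinearMap.sum_apply, map_neg, map_sum]
  rw [hdec]
  exact blockBd_neg (blockBd_sum _ fun μ _ =>
    blockBd_comp_reblock i hlev hβ1 hC hδ m (hT μ) h261 R₀ H₀ (fun _ _ hω z hz => slice_supp i hβ1 μ hω z hz)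
      fun _ _ hω => l2_slice_le i μ hω R₀ H₀)

variable {𝔸 : Type} [NormedRing 𝔸] [NormedAlgebra ℂ 𝔸] [CompleteSpace 𝔸] [FiniteDimensional ℝ 𝔸]
variable {κ : Type} [Fintype κ]
variable (b : Module.Basis κ ℝ 𝔸) (B : B9.Backgrounds) (cfg : B.Cfg → CfgY 𝔸 i) (O : BondOpY 𝔸 i)
variable {Y Z : Type}

/-- ★★★ **THE LETTER `gDv` OF `Letters313L2PZ` AT `U = 1`** — `‖1_{Δ(y)}G₀(1)D_v(1)λ‖ ≤ B₄·Lʲη·e^{−δ′d}·‖1_{Δ(y′)}λ‖` at ANY letter record pinned to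
node00-def-Y's `GcoK … O ∕ DvcoKH` (the certificate's `hG0co12 ∕ hDvco12`), `blk = blkBK bI` (`hblk12`), `blkW = blkSK (sIK bI)` (the site pin), from the
(2.140)₃ torus bound of `G∇*_μ` and the slices `∂λ = −Σ_μ∇*_μJ_μ(λ)`.  Constant `B₄ = cR39 b·(d+1)·C·c·e^{9δ∕4}·√(e^{δ∕4}c)`, rate `¾δ`.
[cite: Balaban1985BackgroundPropagators, Thm 3.13 p.426, (3.153) p.426, (3.46) p.398, (3.3) p.390, Cor. 3.5 p.407; Balaban1984PropagatorsII, Prop. 2.6 (2.140) p.247, Lemma 2.1 (2.61) p.234] -/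
theorem blockBd_G0_Dv_one (hG : GeoOK (geo9K i)) [Fintype (geo9K i).Site]
    (hO : ∀ (J : FBondY i → ℝ) (E : 𝔸), O (fun _ _ => 1) (liftY J E) = liftY (Gop i J) E) {U₁ : B.Cfg} (hU₁ : cfg U₁ = fun _ _ => 1)
    {bI : FBondY i → IBondY i} (hlev : ∀ f : FBondY i, lvl i.hN i.D i.hk (bI f) = (blkV1 i.hN i.D f).1.1)
    (hβ1 : ∀ f : FBondY i, (geomT i.D).dist (β i.hN i.D i.hk (bI f)) (blkV1 i.hN i.D f) ≤ 1)
    (𝔬 : Ops (geo9K i) B (XBK κ i) Y Z (XSK κ i)) (hblk : 𝔬.blk = blkBK i bI) (hblkW : 𝔬.blkW = blkSK i (sIK i bI))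
    (hG0 : 𝔬.G0 U₁ = GcoK i b B cfg O U₁) (hDv : 𝔬.Dv U₁ = DvcoKH i b B cfg U₁)
    {C δ c : ℝ} (hC : 0 ≤ C) (hδ : 0 ≤ δ) (hc0 : 0 ≤ c)
    (hT : ∀ μ : Fin (d + 1), BlockBd (g := geomT i.D) (blkV1 i.hN i.D) (blkV1 i.hN i.D) (Gop i ∘ₗ DVa (P := PV d ℓ i.m i.K hd hL) μ i.cf)
      (fun y y' => C * |i.cf|⁻¹ ^ 1 * ((ℓ : ℝ) + 1) ^ (1 * y.1.1) * Real.exp (-(δ * (geomT i.D).dist y y'))))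
    (h261 : Ineq261With c (geomT i.D) δ (1 / 4)) {R₀ : ℝ} {H₀ : Prop} :
    BlockBd (g := toB6 (geo9K i) R₀ H₀) 𝔬.blkW 𝔬.blk (𝔬.G0 U₁ ∘ₗ 𝔬.Dv U₁)
      (fun y y' => cR39 b * (((d : ℝ) + 1) * (C * c * Real.exp (3 / 4 * δ * 3) * Real.sqrt (Real.exp (1 / 4 * δ) * c))) * (geo9K i).len y *
        Real.exp (-(3 / 4 * δ * (geo9K i).dist y y'))) := by
  rw [hblk, hblkW, hG0, hDv, GcoK_comp_DvcoKH_one i b B cfg O hU₁]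
  have hK := blockBd_coordOpKH_of_liftY b (G := toB6 (geo9K i) R₀ H₀) (blk' := sIK i bI) (blk := bI)
    (T := fun _ : Fin (d + 1) => Gop i ∘ₗ Matrix.toLin' (gradK i)) (fun _ ω E => O_gradY_one_liftY i O hO ω E) ?_
    fun _ => blockBd_comp_gradK_sIK_bI i hlev hβ1 hC hδ 1 hT h261 R₀ H₀
  swap
  · intro a a'; have := (hG.lenpos a).le; positivity
  refine B9SectDL2Decay.BlockBd.mono (blockBd_smul_of_nonneg (G := toB6 (geo9K i) R₀ H₀) hK (cR39_nonneg b)) fun y y' => le_of_eq ?_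
  rw [Finset.card_univ, Fintype.card_fin, show (2 : ℝ) + 1 = 3 by norm_num]
  push_cast
  ring

/-- ★ the composite `∇_U ∘ G₀ ∘ D_v` at the pins, at `U = 1`: `DcoK ∘ GcoK ∘ DvcoKH = cR39 b • coordOpKH b (fun ν => ∇_{1,ν} ∘ O(1) ∘ D_1)`.
[cite: Balaban1985BackgroundPropagators, (3.42) p.397 («∇_U G(U)»), (3.3) p.390, Cor. 3.5 p.407, dictionary] -/
theorem DcoK_GcoK_comp_DvcoKH_one {U₁ : B.Cfg} (hU₁ : cfg U₁ = fun _ _ => 1) :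
    DcoK i b B cfg U₁ ∘ₗ GcoK i b B cfg O U₁ ∘ₗ DvcoKH i b B cfg U₁ =
      cR39 b • coordOpKH b (fun ν : Fin (d + 1) => cdBₗ i (fun _ _ => 1) ν ∘ₗ (O (fun _ _ => 1)).restrictScalars ℝ ∘ₗ
        (gradY i (fun _ _ => 1)).restrictScalars ℝ) := by
  rw [GcoK_comp_DvcoKH_one i b B cfg O hU₁, DcoK, hU₁, LinearMap.comp_smul, coordOpK_comp_coordOpKH]

omit [FiniteDimensional ℝ 𝔸] [Fintype κ] in
/-- the flat family `∇_{1,ν} ∘ O(1) ∘ D_1` acts on product-form inputs as `(∇_ν ∘ G) ∘ ∂♯` (dag-n06-g `cdB_one_liftY`, def-Y `gradY_one`).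
[cite: Balaban1985BackgroundPropagators, (3.42) p.397, (3.3) p.390 + p.395, Cor. 3.5 p.407, dictionary] -/
theorem cdB_O_gradY_one_liftY (hO : ∀ (J : FBondY i → ℝ) (E : 𝔸), O (fun _ _ => 1) (liftY J E) = liftY (Gop i J) E) (ν : Fin (d + 1))
    (ω : SiteY i → ℝ) (E : 𝔸) :
    (cdBₗ i (fun _ _ => 1) ν ∘ₗ (O (fun _ _ => 1)).restrictScalars ℝ ∘ₗ (gradY i (fun _ _ => 1)).restrictScalars ℝ) (liftY ω E) =
      liftY (((DV ν i.cf ∘ₗ Gop i) ∘ₗ Matrix.toLin' (gradK i)) ω) E := by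
  rw [LinearMap.comp_apply, LinearMap.comp_apply, LinearMap.restrictScalars_apply, LinearMap.restrictScalars_apply, gradY_one, liftMatY_liftY, hO,
    cdBₗ_apply, cdB_one_liftY, LinearMap.comp_apply, LinearMap.comp_apply, Matrix.toLin'_apply]

/-- ★★★ **THE LETTER `dGDv` OF `Letters313L2PZ` AT `U = 1`** — `‖1_{Δ(y)}∇_UG₀(1)D_v(1)λ‖ ≤ B₄·e^{−δ′d}‖λ‖` (order zero: the (2.140)₄ member `∇G∇*`),
pins `hG0co12 ∕ hDvco12 ∕ hDco12`, `blkY = blkBK bI`, `blkW = blkSK (sIK bI)`.  Constant `cR39 b·(d+1)·C·c·e^{9δ∕4}·√(e^{δ∕4}c)`, rate `¾δ`.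
[cite: Balaban1985BackgroundPropagators, Thm 3.13 p.426, (3.46) p.398, (3.3) p.390, Cor. 3.5 p.407; Balaban1984PropagatorsII, Prop. 2.6 (2.140) p.247, Lemma 2.1 (2.61) p.234] -/
theorem blockBd_D_G0_Dv_one (hG : GeoOK (geo9K i)) [Fintype (geo9K i).Site]
    (hO : ∀ (J : FBondY i → ℝ) (E : 𝔸), O (fun _ _ => 1) (liftY J E) = liftY (Gop i J) E) {U₁ : B.Cfg} (hU₁ : cfg U₁ = fun _ _ => 1)
    {bI : FBondY i → IBondY i} (hlev : ∀ f : FBondY i, lvl i.hN i.D i.hk (bI f) = (blkV1 i.hN i.D f).1.1)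
    (hβ1 : ∀ f : FBondY i, (geomT i.D).dist (β i.hN i.D i.hk (bI f)) (blkV1 i.hN i.D f) ≤ 1)
    (𝔬 : Ops (geo9K i) B (XBK κ i) (XBK κ i) Z (XSK κ i)) (hblkY : 𝔬.blkY = blkBK i bI) (hblkW : 𝔬.blkW = blkSK i (sIK i bI))
    (hG0 : 𝔬.G0 U₁ = GcoK i b B cfg O U₁) (hDv : 𝔬.Dv U₁ = DvcoKH i b B cfg U₁) (hD : 𝔬.D U₁ = DcoK i b B cfg U₁)
    {C δ c : ℝ} (hC : 0 ≤ C) (hδ : 0 ≤ δ) (hc0 : 0 ≤ c)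
    (hT : ∀ ν μ : Fin (d + 1), BlockBd (g := geomT i.D) (blkV1 i.hN i.D) (blkV1 i.hN i.D) (DV ν i.cf ∘ₗ Gop i ∘ₗ DVa (P := PV d ℓ i.m i.K hd hL) μ i.cf)
      (fun y y' => C * |i.cf|⁻¹ ^ 0 * ((ℓ : ℝ) + 1) ^ (0 * y.1.1) * Real.exp (-(δ * (geomT i.D).dist y y'))))
    (h261 : Ineq261With c (geomT i.D) δ (1 / 4)) {R₀ : ℝ} {H₀ : Prop} :
    BlockBd (g := toB6 (geo9K i) R₀ H₀) 𝔬.blkW 𝔬.blkY (𝔬.D U₁ ∘ₗ 𝔬.G0 U₁ ∘ₗ 𝔬.Dv U₁)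
      (fun y y' => cR39 b * (((d : ℝ) + 1) * (C * c * Real.exp (3 / 4 * δ * 3) * Real.sqrt (Real.exp (1 / 4 * δ) * c))) *
        Real.exp (-(3 / 4 * δ * (geo9K i).dist y y'))) := by
  rw [hblkY, hblkW, hG0, hDv, hD, DcoK_GcoK_comp_DvcoKH_one i b B cfg O hU₁]
  have hK := blockBd_coordOpKH_of_liftY b (G := toB6 (geo9K i) R₀ H₀) (blk' := sIK i bI) (blk := bI)
    (T := fun ν : Fin (d + 1) => (DV ν i.cf ∘ₗ Gop i) ∘ₗ Matrix.toLin' (gradK i)) (fun ν ω E => cdB_O_gradY_one_liftY i O hO ν ω E) ?_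
    fun ν => blockBd_comp_gradK_sIK_bI i hlev hβ1 hC hδ 0 (fun μ => by rw [LinearMap.comp_assoc]; exact hT ν μ) h261 R₀ H₀
  swap
  · intro a a'; positivity
  refine B9SectDL2Decay.BlockBd.mono (blockBd_smul_of_nonneg (G := toB6 (geo9K i) R₀ H₀) hK (cR39_nonneg b)) fun y y' => le_of_eq ?_
  rw [Finset.card_univ, Fintype.card_fin, show (2 : ℝ) + 1 = 3 by norm_num, pow_zero]
  push_cast
  ring

end DvLetters

/-! ## §2 UNIFORMLY ON THE CENSUS: one threshold, one rate, one constant (up to the reading factor `cR39 b` of `GcoK` on the `∂` side) -/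

section Record

variable {𝔸 : Type} [NormedRing 𝔸] [NormedAlgebra ℂ 𝔸] [CompleteSpace 𝔸] [FiniteDimensional ℝ 𝔸]
variable {κ : Type} [Fintype κ]

/-- ★★★ **THE BLOCK-L² LETTERS `gQs`, `gDv`, `dGQs`, `dGDv` OF `Letters313L2PZ` AT `U = 1`, UNIFORMLY ON THE k-LEVEL CENSUS** — four `U = 1` inhabitants of the fields of the
N06 certificate's displayed `hLL2` body (edition 22: `Letters313L2PZ … (vZ := fun y => √(wZ y)) …`, `wZ` = the plateau `((L^{d+1})^{j(y)})⁻¹`): for the band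
`0 < b₀ ≤ b₁` there are `M₁, B₄, δ₄ > 0` such that for every index `i` with `M ≥ M₁`, every basis `b` with `cR39 b ≠ 0`, every letter record `𝔬` over `geo9K i`
with carriers `XBK ∕ Y ∕ XHK ∕ XSK` pinned at a configuration `U₁` reading `1` to `GcoK … O ∕ QscoKH … parB ∕ DvcoKH` (`O(1)(J ⊗ E) = (GJ) ⊗ E`,
transporters trivial at `1`), block maps `blkBK bI ∕ blkHK ∕ blkSK (sIK bI)` with `bI` level- and 1-faithful:
`‖1_{Δ(y)}G₀Q*ω‖ ≤ B₄·(Lʲη)(y)·(√wZ(y′)·(Lʲη)(y′))·e^{−δ₄d}·‖ω‖`, `‖1_{Δ(y)}G₀D_vλ‖ ≤ B₄·cR39 b·(Lʲη)(y)·e^{−δ₄d}·‖λ‖`, `‖1_{Δ(y)}∇_UG₀Q*ω‖ ≤ B₄·(√wZ(y′)·(Lʲη)(y′))·e^{−δ₄d}·‖ω‖`,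
`‖1_{Δ(y)}∇_UG₀D_vλ‖ ≤ B₄·cR39 b·e^{−δ₄d}·‖λ‖` (pins `hG0co12 ∕ hQsco12 ∕ hDvco12 ∕ hDco12`, `hblk12 ∕ hblkY12 ∕ hblkZ12` + the site pin `blkW`).
[cite: Balaban1985BackgroundPropagators, Thm 3.13 p.426, (3.153) p.426, (3.46) p.398, (3.126) p.420, (3.3) p.390, p.398 (remark after (3.47)), Cor. 3.5 p.407; Balaban1984PropagatorsII, Prop. 2.6 (2.140) p.247, Lemma 2.1 (2.60)–(2.61) p.234] -/
theorem letters313_L2_one_kIdx (hb₀ : 0 < b₀) (hb₁ : b₀ ≤ b₁) : ∃ M₁ B₄ δ₄ : ℝ, 0 < M₁ ∧ 0 < B₄ ∧ 0 < δ₄ ∧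
    ∀ i : KIdx d ℓ hd hL b₀ b₁, M₁ ≤ (geo9K i).M → ∀ (hG : GeoOK (geo9K i)) [Fintype (geo9K i).Site]
      (b : Module.Basis κ ℝ 𝔸), cR39 b ≠ 0 → ∀ (B : B9.Backgrounds) (cfg : B.Cfg → CfgY 𝔸 i) (O : BondOpY 𝔸 i) (parB : BondParY 𝔸 i),
      (∀ s s', parB (fun _ _ => 1) s s' = 1) → (∀ (J : FBondY i → ℝ) (E : 𝔸), O (fun _ _ => 1) (liftY J E) = liftY (Gop i J) E) →
      ∀ {U₁ : B.Cfg}, cfg U₁ = (fun _ _ => 1) → ∀ {bI : FBondY i → IBondY i},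
      (∀ f : FBondY i, lvl i.hN i.D i.hk (bI f) = (blkV1 i.hN i.D f).1.1) →
      (∀ f : FBondY i, (geomT i.D).dist (β i.hN i.D i.hk (bI f)) (blkV1 i.hN i.D f) ≤ 1) →
      ∀ (𝔬 : Ops (geo9K i) B (XBK κ i) (XBK κ i) (XHK κ i) (XSK κ i)),
      𝔬.blk = blkBK i bI → 𝔬.blkY = blkBK i bI → 𝔬.blkZ = blkHK i → 𝔬.blkW = blkSK i (sIK i bI) →
      𝔬.G0 U₁ = GcoK i b B cfg O U₁ → 𝔬.Qstar U₁ = QscoKH i b B cfg parB U₁ → 𝔬.Dv U₁ = DvcoKH i b B cfg U₁ → 𝔬.D U₁ = DcoK i b B cfg U₁ →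
      ∀ {R₀ : ℝ} {H₀ : Prop},
        BlockBd (g := toB6 (geo9K i) R₀ H₀) 𝔬.blkZ 𝔬.blk (𝔬.G0 U₁ ∘ₗ 𝔬.Qstar U₁)
          (fun y y' => B₄ * (geo9K i).len y * (Real.sqrt (((((ℓ + 1 : ℕ) : ℝ) ^ (d + 1)) ^ lvl i.hN i.D i.hk y')⁻¹) * (geo9K i).len y') *
            Real.exp (-(δ₄ * (geo9K i).dist y y'))) ∧
        BlockBd (g := toB6 (geo9K i) R₀ H₀) 𝔬.blkW 𝔬.blk (𝔬.G0 U₁ ∘ₗ 𝔬.Dv U₁)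
          (fun y y' => B₄ * cR39 b * (geo9K i).len y * Real.exp (-(δ₄ * (geo9K i).dist y y'))) ∧
        BlockBd (g := toB6 (geo9K i) R₀ H₀) 𝔬.blkZ 𝔬.blkY (𝔬.D U₁ ∘ₗ 𝔬.G0 U₁ ∘ₗ 𝔬.Qstar U₁)
          (fun y y' => B₄ * (Real.sqrt (((((ℓ + 1 : ℕ) : ℝ) ^ (d + 1)) ^ lvl i.hN i.D i.hk y')⁻¹) * (geo9K i).len y') *
            Real.exp (-(δ₄ * (geo9K i).dist y y'))) ∧
        BlockBd (g := toB6 (geo9K i) R₀ H₀) 𝔬.blkW 𝔬.blkY (𝔬.D U₁ ∘ₗ 𝔬.G0 U₁ ∘ₗ 𝔬.Dv U₁)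
          (fun y y' => B₄ * cR39 b * Real.exp (-(δ₄ * (geo9K i).dist y y'))) := by
  obtain ⟨M₁, δ₃, C, hM₁, hδ₃, hC, H⟩ := blockBd_Gop_kIdx (d := d) (ℓ := ℓ) (hd := hd) (hL := hL) hb₀ hb₁
  obtain ⟨N, c, -, hc0, hcon⟩ := consts_260_261 d ℓ hδ₃
  set Lr : ℝ := (((ℓ + 1 : ℕ) : ℝ)) with hLr
  have hLr1 : 1 ≤ Lr := by rw [hLr]; exact_mod_cast Nat.succ_le_succ (Nat.zero_le ℓ)
  set lg : ℝ := Real.log Lr with hlg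
  have hlg0 : 0 ≤ lg := Real.log_nonneg hLr1
  set AQ : ℝ := C * c * Real.exp (3 / 4 * δ₃ * ((ℓ : ℝ) + 4)) * Real.sqrt (Real.exp (1 / 4 * δ₃) * c) * Lr with hAQ
  set AD : ℝ := ((d : ℝ) + 1) * (C * c * Real.exp (3 / 4 * δ₃ * 3) * Real.sqrt (Real.exp (1 / 4 * δ₃) * c)) with hAD
  have hAQ0 : 0 ≤ AQ := by positivity
  have hAD0 : 0 ≤ AD := by positivity
  set B₄ : ℝ := max AQ AD + 1 with hB₄
  have hB₄pos : 0 < B₄ := by have := le_max_left AQ AD; linarith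
  have hAQB : AQ ≤ B₄ := by have := le_max_left AQ AD; linarith
  have hADB : AD ≤ B₄ := by have := le_max_right AQ AD; linarith
  refine ⟨max (max M₁ ((N : ℝ) + 1)) (4 * lg / δ₃), B₄, δ₃ / 2, lt_max_of_lt_left (lt_max_of_lt_left hM₁), hB₄pos, by positivity, ?_⟩
  intro i hM hG _ b hc B cfg O parB hparB hO U₁ hU₁ bI hlev hβ1 𝔬 hblk hblkY hblkZ hblkW hG0 hQs hDv hD R₀ H₀
  have hLcast : (((ℓ + 1 : ℕ) : ℝ)) = (ℓ : ℝ) + 1 := by push_cast; ring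
  have hMdef : (geo9K i).M = (((ℓ + 1 : ℕ) : ℝ)) * (i.Mh : ℝ) := rfl
  have hLdef : (geo9K i).L = Lr := rfl
  have hM₁ : M₁ ≤ (kGeoG i).M := ((le_max_left _ _).trans (le_max_left _ _)).trans hM
  have hN : (N : ℝ) + 1 ≤ ((ℓ : ℝ) + 1) * i.Mh := by
    rw [← hLcast, ← hMdef]; exact ((le_max_right _ _).trans (le_max_left _ _)).trans hM
  have hMw : 4 * lg ≤ (geo9K i).M * δ₃ := (div_le_iff₀ hδ₃).mp ((le_max_right _ _).trans hM)
  have hR1 : 1 ≤ i.R := le_trans (by omega) (toKT i).hR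
  have hRN : N + 1 ≤ i.R * ((ℓ + 1) * i.Mh) := by
    have h2 : N + 1 ≤ (ℓ + 1) * i.Mh := by exact_mod_cast hN
    calc N + 1 ≤ 1 * ((ℓ + 1) * i.Mh) := by rw [one_mul]; exact h2
      _ ≤ i.R * ((ℓ + 1) * i.Mh) := Nat.mul_le_mul_right _ hR1
  obtain ⟨-, h261⟩ := hcon i.k i.Mh i.R i.P' (one_le_Mh i) (toKT i).hP hRN
  have h261D : Ineq261With c (geomT i.D) δ₃ (1 / 4) := h261 i.D
  obtain ⟨h0, h1, h2, h3, -, -⟩ := H i hM₁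
  have hε4 : 0 < δ₃ / 4 := by positivity
  have hMg1 : ((1 : ℕ) : ℝ) * lg / (δ₃ / 4) ≤ (geo9K i).M := by rw [div_le_iff₀ hε4]; push_cast; linarith
  have hT1 := transfer_threshold i hε4 1 hMg1
  -- the two bodies
  have hQ := blockBd_G0_Qstar_one (Y := XBK κ i) (W := XSK κ i) (R₀ := R₀) (H₀ := H₀) i b B cfg O parB hG hc hparB hO hU₁ hlev hβ1 𝔬 hblk hblkZ hG0 hQs
    hC.le hδ₃.le hc0 h0 h261D hε4 (by simpa using hT1)
  have hDvb := blockBd_G0_Dv_one (Y := XBK κ i) (Z := XHK κ i) (R₀ := R₀) (H₀ := H₀) i b B cfg O hG hO hU₁ hlev hβ1 𝔬 hblk hblkW hG0 hDv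
    hC.le hδ₃.le hc0 h2 h261D
  have hDQ := blockBd_D_G0_Qstar_one (W := XSK κ i) (R₀ := R₀) (H₀ := H₀) i b B cfg O parB hG hc hparB hO hU₁ hlev hβ1 𝔬 hblkY hblkZ hG0 hQs hD
    hC.le hδ₃.le hc0 h1 h261D hε4 (by simpa using hT1)
  have hDD := blockBd_D_G0_Dv_one (Z := XHK κ i) (R₀ := R₀) (H₀ := H₀) i b B cfg O hG hO hU₁ hlev hβ1 𝔬 hblkY hblkW hG0 hDv hD
    hC.le hδ₃.le hc0 h3 h261D
  have hcb : 0 ≤ cR39 b := cR39_nonneg b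
  refine ⟨B9SectDL2Decay.BlockBd.mono hQ fun y y' => ?_, B9SectDL2Decay.BlockBd.mono hDvb fun y y' => ?_,
    B9SectDL2Decay.BlockBd.mono hDQ fun y y' => ?_, B9SectDL2Decay.BlockBd.mono hDD fun y y' => ?_⟩
  · have hre : Real.exp (-((3 / 4 * δ₃ - δ₃ / 4) * (geo9K i).dist y y')) = Real.exp (-(δ₃ / 2 * (geo9K i).dist y y')) := by
      congr 1; ring
    rw [hre, hLdef]
    have hX : 0 ≤ (geo9K i).len y * (Real.sqrt (((((ℓ + 1 : ℕ) : ℝ) ^ (d + 1)) ^ lvl i.hN i.D i.hk y')⁻¹) * (geo9K i).len y') *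
        Real.exp (-(δ₃ / 2 * (geo9K i).dist y y')) := by
      have := (hG.lenpos y).le; have := (hG.lenpos y').le; positivity
    calc C * c * Real.exp (3 / 4 * δ₃ * ((ℓ : ℝ) + 4)) * Real.sqrt (Real.exp (1 / 4 * δ₃) * c) * Lr * (geo9K i).len y *
          (Real.sqrt (((((ℓ + 1 : ℕ) : ℝ) ^ (d + 1)) ^ lvl i.hN i.D i.hk y')⁻¹) * (geo9K i).len y') * Real.exp (-(δ₃ / 2 * (geo9K i).dist y y'))
        = AQ * ((geo9K i).len y * (Real.sqrt (((((ℓ + 1 : ℕ) : ℝ) ^ (d + 1)) ^ lvl i.hN i.D i.hk y')⁻¹) * (geo9K i).len y') *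
          Real.exp (-(δ₃ / 2 * (geo9K i).dist y y'))) := by rw [hAQ]; ring
      _ ≤ B₄ * ((geo9K i).len y * (Real.sqrt (((((ℓ + 1 : ℕ) : ℝ) ^ (d + 1)) ^ lvl i.hN i.D i.hk y')⁻¹) * (geo9K i).len y') *
          Real.exp (-(δ₃ / 2 * (geo9K i).dist y y'))) := mul_le_mul_of_nonneg_right hAQB hX
      _ = _ := by ring
  · have hda : 0 ≤ (geo9K i).dist y y' := hG.dnn y y'
    have hrate : Real.exp (-(3 / 4 * δ₃ * (geo9K i).dist y y')) ≤ Real.exp (-(δ₃ / 2 * (geo9K i).dist y y')) :=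
      Real.exp_le_exp.2 (by nlinarith)
    have hly : 0 ≤ (geo9K i).len y := (hG.lenpos y).le
    calc cR39 b * (((d : ℝ) + 1) * (C * c * Real.exp (3 / 4 * δ₃ * 3) * Real.sqrt (Real.exp (1 / 4 * δ₃) * c))) * (geo9K i).len y *
          Real.exp (-(3 / 4 * δ₃ * (geo9K i).dist y y'))
        = (cR39 b * (geo9K i).len y) * (AD * Real.exp (-(3 / 4 * δ₃ * (geo9K i).dist y y'))) := by rw [hAD]; ring
      _ ≤ (cR39 b * (geo9K i).len y) * (B₄ * Real.exp (-(δ₃ / 2 * (geo9K i).dist y y'))) :=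
          mul_le_mul_of_nonneg_left (mul_le_mul hADB hrate (Real.exp_pos _).le hB₄pos.le) (mul_nonneg hcb hly)
      _ = _ := by ring

  · have hre : Real.exp (-((3 / 4 * δ₃ - δ₃ / 4) * (geo9K i).dist y y')) = Real.exp (-(δ₃ / 2 * (geo9K i).dist y y')) := by
      congr 1; ring
    rw [hre, hLdef]
    have hX : 0 ≤ (Real.sqrt (((((ℓ + 1 : ℕ) : ℝ) ^ (d + 1)) ^ lvl i.hN i.D i.hk y')⁻¹) * (geo9K i).len y') *
        Real.exp (-(δ₃ / 2 * (geo9K i).dist y y')) := by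
      have := (hG.lenpos y').le; positivity
    have hAQ1 : C * c * Real.exp (3 / 4 * δ₃ * ((ℓ : ℝ) + 4)) * Real.sqrt (Real.exp (1 / 4 * δ₃) * c) * Lr ≤ B₄ := hAQB
    calc C * c * Real.exp (3 / 4 * δ₃ * ((ℓ : ℝ) + 4)) * Real.sqrt (Real.exp (1 / 4 * δ₃) * c) * Lr *
          (Real.sqrt (((((ℓ + 1 : ℕ) : ℝ) ^ (d + 1)) ^ lvl i.hN i.D i.hk y')⁻¹) * (geo9K i).len y') * Real.exp (-(δ₃ / 2 * (geo9K i).dist y y'))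
        = AQ * ((Real.sqrt (((((ℓ + 1 : ℕ) : ℝ) ^ (d + 1)) ^ lvl i.hN i.D i.hk y')⁻¹) * (geo9K i).len y') *
          Real.exp (-(δ₃ / 2 * (geo9K i).dist y y'))) := by rw [hAQ]; ring
      _ ≤ B₄ * ((Real.sqrt (((((ℓ + 1 : ℕ) : ℝ) ^ (d + 1)) ^ lvl i.hN i.D i.hk y')⁻¹) * (geo9K i).len y') *
          Real.exp (-(δ₃ / 2 * (geo9K i).dist y y'))) := mul_le_mul_of_nonneg_right hAQB hX
      _ = _ := by ring
  · have hda : 0 ≤ (geo9K i).dist y y' := hG.dnn y y'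
    have hrate : Real.exp (-(3 / 4 * δ₃ * (geo9K i).dist y y')) ≤ Real.exp (-(δ₃ / 2 * (geo9K i).dist y y')) :=
      Real.exp_le_exp.2 (by nlinarith)
    calc cR39 b * (((d : ℝ) + 1) * (C * c * Real.exp (3 / 4 * δ₃ * 3) * Real.sqrt (Real.exp (1 / 4 * δ₃) * c))) *
          Real.exp (-(3 / 4 * δ₃ * (geo9K i).dist y y'))
        = cR39 b * (AD * Real.exp (-(3 / 4 * δ₃ * (geo9K i).dist y y'))) := by rw [hAD]; ring
      _ ≤ cR39 b * (B₄ * Real.exp (-(δ₃ / 2 * (geo9K i).dist y y'))) :=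
          mul_le_mul_of_nonneg_left (mul_le_mul hADB hrate (Real.exp_pos _).le hB₄pos.le) hcb
      _ = _ := by ring

end Record

end Literature.MathematicalPhysics.QuantumFieldTheory.Balaban1983to89.B9Letters313AtOneL2Dv

end
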